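import Summits.QuantumFields.QCD.Theorems.SpectralDefectExtinctionTipNoBindingFreeSymbol
import Mathlib.Analysis.Normed.Algebra.MatrixExponential

/-!
# The free massless Wilson heat kernel in torus Fourier variables
(helper for item stmt-QuantumFields-8877, `FreeKernelPowerCounting`, route HeatSlicedQuarks)

For the FREE (`U ≡ 1`), massless, `r = 1` Wilson–Dirac operator `D₀` of the tree on the four-torus
`(ℤ/L)⁴` with colour `Fin 3` and spin `Fin 4`, the positive operator `H = D₀ᴴ D₀` is diagonalised by
the unitary plane-wave matrix `P((x,a,α),(k,b,β)) = L⁻² χ_k(x) δ_{(a,α),(b,β)}` (`P = F ⊗ 1`,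
`F(x,k) = L⁻² χ_k(x)`): `Pᴴ H P = diagonal (h(k))` with the scalar symbol
`h(k) = (Σ_μ (1 − cos θ_μ))² + Σ_μ sin² θ_μ`, `θ_μ = 2π k_μ.val / L`
(`D₀ P = Q` carries the normal colour–spin symbol `M(k) = W(k)·1 + iΣ_μ sin θ_μ γ_μ` of
`SpectralDefectExtinctionTipNoBindingFreeSymbol`, squared to a scalar by the Clifford identity there).
Hence `exp(−tH) = P · diagonal(e^{−t h}) · Pᴴ` (`Matrix.exp_conj`, `Matrix.exp_diagonal`) and the
entries are `exp(−tH)((x,a,α),(y,b,β)) = δ_{(a,α),(b,β)} · L⁻⁴ Σ_k e^{−t h(k)} χ_k(x) conj χ_k(y)`;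
on site (`y = x`) this is the real Fourier sum `L⁻⁴ Σ_k e^{−t h(k)}`, diagonal in colour–spin
(`exp_freeWilson_apply_site`).  The matrices `F`, `P = F ⊗ 1`, `Q = D₀P` and the symbols `M(k)`,
`h(k)` are written out in full in the statements (no definitions, no notation).

References: Montvay–Münster, *Quantum Fields on a Lattice* §4.2 (free Wilson fermions in momentum
space); the diagonalisation is folklore.  Pure theorem file (no definitions).
-/

namespace Summit.QuantumFields.QCD.Theorems.HeatSlicedQuarks.FreeKernel

open Literature.MathematicalPhysics Literature.MathematicalPhysics.QuantumLattice
  Literature.MathematicalPhysics.QuantumFieldTheory Literature.Probability.LatticeModels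
open Summit.QuantumFields.QCD.Cruxes.TipNoBinding.PositivityNoLeakSpread
open Matrix Complex Finset
open scoped ComplexConjugate Real Kronecker

noncomputable section

/-! ### Abstract step: heat kernel of `AᴴA` from a unitary diagonalisation of `A P` -/

section Abstract

variable {ι : Type*} [Fintype ι] [DecidableEq ι]

/-- If `Pᴴ P = 1` and `(A P)ᴴ (A P) = diagonal d` (real `d`), then for every real `t` the heat kernel
is `exp(−t AᴴA) = P · diagonal (e^{−t d}) · Pᴴ`. -/
theorem exp_neg_smul_conjTranspose_mul_self_eq (P A : Matrix ι ι ℂ) (d : ι → ℝ)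
    (hP : Pᴴ * P = 1) (hd : (A * P)ᴴ * (A * P) = diagonal fun q => ((d q : ℝ) : ℂ)) (t : ℝ) :
    NormedSpace.exp (-(t : ℂ) • (Aᴴ * A)) =
      P * diagonal (fun q => Complex.exp (-(t : ℂ) * ((d q : ℝ) : ℂ))) * Pᴴ := by
  have hinv : P⁻¹ = Pᴴ := Matrix.inv_eq_left_inv hP
  have hdet : IsUnit P.det := Matrix.isUnit_det_of_left_inverse hP
  have hunit : IsUnit P := (Matrix.isUnit_iff_isUnit_det P).mpr hdet
  have hPP : P * Pᴴ = 1 := by rw [← hinv]; exact Matrix.mul_nonsing_inv P hdet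
  -- `AᴴA = P · diagonal d · Pᴴ`
  have hH : Aᴴ * A = P * diagonal (fun q => ((d q : ℝ) : ℂ)) * Pᴴ := by
    have h1 : Pᴴ * (Aᴴ * A) * P = diagonal fun q => ((d q : ℝ) : ℂ) := by
      rw [← hd, conjTranspose_mul]
      simp only [Matrix.mul_assoc]
    calc Aᴴ * A = (P * Pᴴ) * (Aᴴ * A) * (P * Pᴴ) := by rw [hPP, Matrix.one_mul, Matrix.mul_one]
      _ = P * (Pᴴ * (Aᴴ * A) * P) * Pᴴ := by simp only [Matrix.mul_assoc]
      _ = P * diagonal (fun q => ((d q : ℝ) : ℂ)) * Pᴴ := by rw [h1]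
  have hspec : -(t : ℂ) • (Aᴴ * A) =
      P * diagonal (fun q => -(t : ℂ) * ((d q : ℝ) : ℂ)) * P⁻¹ := by
    rw [hH, hinv, ← Matrix.smul_mul, ← Matrix.mul_smul, ← Matrix.diagonal_smul]
    rfl
  have hwexp : NormedSpace.exp (fun q => -(t : ℂ) * ((d q : ℝ) : ℂ)) =
      fun q => Complex.exp (-(t : ℂ) * ((d q : ℝ) : ℂ)) := by
    funext q
    rw [Pi.coe_exp, Complex.exp_eq_exp_ℂ]
  rw [hspec, Matrix.exp_conj _ _ hunit, Matrix.exp_diagonal, hwexp, hinv]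

/-- Entrywise form of `exp_neg_smul_conjTranspose_mul_self_eq`:
`exp(−t AᴴA)(i,j) = Σ_q P(i,q) e^{−t d(q)} conj P(j,q)`. -/
theorem exp_neg_smul_conjTranspose_mul_self_apply (P A : Matrix ι ι ℂ) (d : ι → ℝ)
    (hP : Pᴴ * P = 1) (hd : (A * P)ᴴ * (A * P) = diagonal fun q => ((d q : ℝ) : ℂ)) (t : ℝ)
    (i j : ι) :
    (NormedSpace.exp (-(t : ℂ) • (Aᴴ * A))) i j =
      ∑ q, P i q * Complex.exp (-(t : ℂ) * ((d q : ℝ) : ℂ)) * conj (P j q) := by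
  rw [exp_neg_smul_conjTranspose_mul_self_eq P A d hP hd t, Matrix.mul_apply]
  refine Finset.sum_congr rfl fun q _ => ?_
  rw [Matrix.mul_diagonal, Matrix.conjTranspose_apply, Complex.star_def]

end Abstract

/-! ### The free Wilson–Dirac operator on plane waves -/

section Concrete

variable {L : ℕ} [NeZero L]

/-- The character at a unit vector: `χ_k(e_μ) = cos θ_μ + i sin θ_μ`, `θ_μ = 2π k_μ.val / L`. -/
theorem torusChar_single_eq_cos_add_sin (k : TorusSite 4 L) (μ : Fin 4) :
    torusChar k (Pi.single μ 1) =
      ((Real.cos (2 * π * ((k μ).val : ℝ) / L) : ℝ) : ℂ) +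
        ((Real.sin (2 * π * ((k μ).val : ℝ) / L) : ℝ) : ℂ) * I := by
  rw [torusChar_single_eq_exp, Complex.exp_mul_I, ← Complex.ofReal_cos, ← Complex.ofReal_sin]

/-- **The free Wilson–Dirac operator on a plane wave** (colour `b`, spin `β`, momentum `k`):
`D₀ (χ_k ⊗ e_b ⊗ e_β) = χ_k ⊗ e_b ⊗ M(k) e_β` with the colour–spin symbol
`M(k) = W(k)·1 + i Σ_μ sin θ_μ γ_μ`, `W(k) = Σ_μ (1 − cos θ_μ)`, `θ_μ = 2π k_μ.val / L`. -/
theorem wilsonDirac_one_mulVec_planeWave (k : TorusSite 4 L) (b : Fin 3) (β : Fin 4) :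
    wilsonDirac (fundamentalRep (Fin 3)) (1 : GaugeConfig 4 L (Matrix.specialUnitaryGroup (Fin 3) ℂ)) 0 1 *ᵥ
        (fun l : TorusSite 4 L × Fin 3 × Fin 4 => torusChar k l.1 * if l.2 = (b, β) then 1 else 0) =
      fun p => torusChar k p.1 *
        if p.2.1 = b then
          ((((∑ μ : Fin 4, (1 - Real.cos (2 * π * (ZMod.val (k μ) : ℝ) / L))) : ℝ) : ℂ) • (1 : Matrix (Fin 4) (Fin 4) ℂ) +
          I • ∑ μ : Fin 4, ((Real.sin (2 * π * (ZMod.val (k μ) : ℝ) / L) : ℝ) : ℂ) • euclideanGamma μ) p.2.2 β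
        else 0 := by
  funext p
  obtain ⟨x, a, α⟩ := p
  rw [wilsonDirac_one_mulVec_apply]
  dsimp only
  by_cases hab : a = b
  · subst hab
    simp only [Prod.mk.injEq, true_and, if_true, mul_ite, mul_one, mul_zero, Finset.sum_add_distrib,
      Finset.sum_ite_eq', Finset.mem_univ]
    simp only [torusChar_add_right, torusChar_sub_right, torusChar_single_eq_cos_add_sin, map_add,
      map_mul, Complex.conj_ofReal, Complex.conj_I]
    simp only [Matrix.add_apply, Matrix.sub_apply, Matrix.smul_apply, smul_eq_mul, Matrix.one_apply,
      Fin.sum_univ_four]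
    push_cast
    split_ifs <;> ring
  · simp only [Prod.mk.injEq, hab, false_and, if_false, mul_zero, add_zero, Finset.sum_const_zero,
      sub_zero]

/-- **Orthonormality of the normalised plane waves** `F(x,k) = L⁻² χ_k(x)`: `Fᴴ F = 1`
(character orthogonality on `(ℤ/L)⁴`). -/
theorem planeF_conjTranspose_mul_self :
    (Matrix.of fun x k : TorusSite 4 L => ((L : ℂ) ^ 2)⁻¹ * torusChar k x)ᴴ *
        (Matrix.of fun x k : TorusSite 4 L => ((L : ℂ) ^ 2)⁻¹ * torusChar k x) = 1 := by
  ext k k'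
  rw [Matrix.mul_apply, Matrix.one_apply]
  have hx : ∀ x : TorusSite 4 L,
      (Matrix.of fun x k : TorusSite 4 L => ((L : ℂ) ^ 2)⁻¹ * torusChar k x)ᴴ k x *
          (Matrix.of fun x k : TorusSite 4 L => ((L : ℂ) ^ 2)⁻¹ * torusChar k x) x k' =
        (((L : ℂ) ^ 2)⁻¹ * ((L : ℂ) ^ 2)⁻¹) * torusChar (k' - k) x := by
    intro x
    rw [Matrix.conjTranspose_apply, Matrix.of_apply, Matrix.of_apply, Complex.star_def, map_mul,
      map_inv₀, map_pow, map_natCast, torusChar_sub_left]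
    ring
  simp_rw [hx]
  rw [← Finset.mul_sum, sum_torusChar_right]
  by_cases hk : k = k'
  · subst hk
    rw [if_pos (sub_self k), if_pos rfl]
    have hL : (L : ℂ) ≠ 0 := Nat.cast_ne_zero.2 (NeZero.ne L)
    field_simp
  · rw [if_neg (fun h => hk (sub_eq_zero.mp h).symm), if_neg hk, mul_zero]

/-- The plane-wave matrix `P = F ⊗ 1` on sites × (colour × spin) is an isometry: `Pᴴ P = 1`. -/
theorem planeP_conjTranspose_mul_self :
    ((Matrix.of fun x k : TorusSite 4 L => ((L : ℂ) ^ 2)⁻¹ * torusChar k x) ⊗ₖ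
        (1 : Matrix (Fin 3 × Fin 4) (Fin 3 × Fin 4) ℂ))ᴴ *
        ((Matrix.of fun x k : TorusSite 4 L => ((L : ℂ) ^ 2)⁻¹ * torusChar k x) ⊗ₖ
        (1 : Matrix (Fin 3 × Fin 4) (Fin 3 × Fin 4) ℂ)) = 1 := by
  rw [conjTranspose_kronecker, ← mul_kronecker_mul, planeF_conjTranspose_mul_self, conjTranspose_one,
    Matrix.one_mul, one_kronecker_one]

/-- **`D₀ P = Q`**: on plane waves the free operator acts by the colour–spin symbol `1 ⊗ M(k)`. -/
theorem wilsonDirac_one_mul_planeP :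
    wilsonDirac (fundamentalRep (Fin 3)) (1 : GaugeConfig 4 L (Matrix.specialUnitaryGroup (Fin 3) ℂ)) 0 1 *
        ((Matrix.of fun x k : TorusSite 4 L => ((L : ℂ) ^ 2)⁻¹ * torusChar k x) ⊗ₖ
        (1 : Matrix (Fin 3 × Fin 4) (Fin 3 × Fin 4) ℂ)) =
      (Matrix.of fun p q : TorusSite 4 L × Fin 3 × Fin 4 =>
        (Matrix.of fun x k : TorusSite 4 L => ((L : ℂ) ^ 2)⁻¹ * torusChar k x) p.1 q.1 *
          ((1 : Matrix (Fin 3) (Fin 3) ℂ) ⊗ₖ ((((∑ μ : Fin 4, (1 - Real.cos (2 * π * (ZMod.val (q.1 μ) : ℝ) / L))) : ℝ) : ℂ) • (1 : Matrix (Fin 4) (Fin 4) ℂ) +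
          I • ∑ μ : Fin 4, ((Real.sin (2 * π * (ZMod.val (q.1 μ) : ℝ) / L) : ℝ) : ℂ) • euclideanGamma μ)) p.2 q.2) := by
  ext p q
  have hcol : (fun l : TorusSite 4 L × Fin 3 × Fin 4 =>
      ((Matrix.of fun x k : TorusSite 4 L => ((L : ℂ) ^ 2)⁻¹ * torusChar k x) ⊗ₖ
        (1 : Matrix (Fin 3 × Fin 4) (Fin 3 × Fin 4) ℂ)) l q) =
      ((L : ℂ) ^ 2)⁻¹ • fun l => torusChar q.1 l.1 * if l.2 = (q.2.1, q.2.2) then 1 else 0 := by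
    funext l
    rw [Pi.smul_apply, smul_eq_mul, Matrix.kroneckerMap_apply, Matrix.of_apply, Matrix.one_apply,
      Prod.mk.eta, mul_assoc]
  rw [Matrix.mul_apply', dotProduct, show (∑ l, wilsonDirac (fundamentalRep (Fin 3)) (1 : GaugeConfig 4 L (Matrix.specialUnitaryGroup (Fin 3) ℂ)) 0 1 p l *
      ((Matrix.of fun x k : TorusSite 4 L => ((L : ℂ) ^ 2)⁻¹ * torusChar k x) ⊗ₖ
        (1 : Matrix (Fin 3 × Fin 4) (Fin 3 × Fin 4) ℂ)) l q) =
      (wilsonDirac (fundamentalRep (Fin 3)) (1 : GaugeConfig 4 L (Matrix.specialUnitaryGroup (Fin 3) ℂ)) 0 1 *ᵥ fun l =>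
        ((Matrix.of fun x k : TorusSite 4 L => ((L : ℂ) ^ 2)⁻¹ * torusChar k x) ⊗ₖ
        (1 : Matrix (Fin 3 × Fin 4) (Fin 3 × Fin 4) ℂ)) l q) p from rfl,
    hcol, Matrix.mulVec_smul, Pi.smul_apply, wilsonDirac_one_mulVec_planeWave, smul_eq_mul,
    Matrix.of_apply, Matrix.of_apply, Matrix.kroneckerMap_apply, Matrix.one_apply, ite_mul, one_mul,
    zero_mul, mul_assoc]

/-- `conj` of an entry of the identity matrix is the transposed entry (the identity is real). -/
theorem conj_one_apply {n : Type*} [DecidableEq n] (i j : n) :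
    conj ((1 : Matrix n n ℂ) i j) = (1 : Matrix n n ℂ) j i := by
  rw [← Complex.star_def, ← Matrix.conjTranspose_apply, Matrix.conjTranspose_one]

/-- **`Qᴴ Q` is diagonal with the scalar symbol**: `(D₀P)ᴴ (D₀P) = diagonal (h(k))`,
`h(k) = W(k)² + Σ_μ sin² θ_μ` (plane-wave orthonormality in the site factor, the Clifford identity
`M(k)ᴴ M(k) = h(k)·1` in the spin factor). -/
theorem symQ_conjTranspose_mul_self :
    (Matrix.of fun p q : TorusSite 4 L × Fin 3 × Fin 4 =>
        (Matrix.of fun x k : TorusSite 4 L => ((L : ℂ) ^ 2)⁻¹ * torusChar k x) p.1 q.1 *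
          ((1 : Matrix (Fin 3) (Fin 3) ℂ) ⊗ₖ ((((∑ μ : Fin 4, (1 - Real.cos (2 * π * (ZMod.val (q.1 μ) : ℝ) / L))) : ℝ) : ℂ) • (1 : Matrix (Fin 4) (Fin 4) ℂ) +
          I • ∑ μ : Fin 4, ((Real.sin (2 * π * (ZMod.val (q.1 μ) : ℝ) / L) : ℝ) : ℂ) • euclideanGamma μ)) p.2 q.2)ᴴ *
        (Matrix.of fun p q : TorusSite 4 L × Fin 3 × Fin 4 =>
        (Matrix.of fun x k : TorusSite 4 L => ((L : ℂ) ^ 2)⁻¹ * torusChar k x) p.1 q.1 *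
          ((1 : Matrix (Fin 3) (Fin 3) ℂ) ⊗ₖ ((((∑ μ : Fin 4, (1 - Real.cos (2 * π * (ZMod.val (q.1 μ) : ℝ) / L))) : ℝ) : ℂ) • (1 : Matrix (Fin 4) (Fin 4) ℂ) +
          I • ∑ μ : Fin 4, ((Real.sin (2 * π * (ZMod.val (q.1 μ) : ℝ) / L) : ℝ) : ℂ) • euclideanGamma μ)) p.2 q.2) =
      diagonal fun q : TorusSite 4 L × Fin 3 × Fin 4 =>
        ((((∑ μ : Fin 4, (1 - Real.cos (2 * π * (ZMod.val (q.1 μ) : ℝ) / L))) ^ 2 +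
          ∑ μ : Fin 4, Real.sin (2 * π * (ZMod.val (q.1 μ) : ℝ) / L) ^ 2) : ℝ) : ℂ) := by
  ext q q'
  obtain ⟨k, s₀⟩ := q
  obtain ⟨k', s₀'⟩ := q'
  rw [Matrix.mul_apply, Fintype.sum_prod_type, Matrix.diagonal_apply]
  have hs : ∀ (x : TorusSite 4 L) (s : Fin 3 × Fin 4),
      (Matrix.of fun p q : TorusSite 4 L × Fin 3 × Fin 4 =>
        (Matrix.of fun x k : TorusSite 4 L => ((L : ℂ) ^ 2)⁻¹ * torusChar k x) p.1 q.1 *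
          ((1 : Matrix (Fin 3) (Fin 3) ℂ) ⊗ₖ ((((∑ μ : Fin 4, (1 - Real.cos (2 * π * (ZMod.val (q.1 μ) : ℝ) / L))) : ℝ) : ℂ) • (1 : Matrix (Fin 4) (Fin 4) ℂ) +
          I • ∑ μ : Fin 4, ((Real.sin (2 * π * (ZMod.val (q.1 μ) : ℝ) / L) : ℝ) : ℂ) • euclideanGamma μ)) p.2 q.2)ᴴ (k, s₀) (x, s) *
        (Matrix.of fun p q : TorusSite 4 L × Fin 3 × Fin 4 =>
        (Matrix.of fun x k : TorusSite 4 L => ((L : ℂ) ^ 2)⁻¹ * torusChar k x) p.1 q.1 *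
          ((1 : Matrix (Fin 3) (Fin 3) ℂ) ⊗ₖ ((((∑ μ : Fin 4, (1 - Real.cos (2 * π * (ZMod.val (q.1 μ) : ℝ) / L))) : ℝ) : ℂ) • (1 : Matrix (Fin 4) (Fin 4) ℂ) +
          I • ∑ μ : Fin 4, ((Real.sin (2 * π * (ZMod.val (q.1 μ) : ℝ) / L) : ℝ) : ℂ) • euclideanGamma μ)) p.2 q.2) (x, s) (k', s₀') =
        ((Matrix.of fun x k : TorusSite 4 L => ((L : ℂ) ^ 2)⁻¹ * torusChar k x)ᴴ k x *
            (Matrix.of fun x k : TorusSite 4 L => ((L : ℂ) ^ 2)⁻¹ * torusChar k x) x k') *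
          ((((1 : Matrix (Fin 3) (Fin 3) ℂ) ⊗ₖ ((((∑ μ : Fin 4, (1 - Real.cos (2 * π * (ZMod.val (k μ) : ℝ) / L))) : ℝ) : ℂ) • (1 : Matrix (Fin 4) (Fin 4) ℂ) +
          I • ∑ μ : Fin 4, ((Real.sin (2 * π * (ZMod.val (k μ) : ℝ) / L) : ℝ) : ℂ) • euclideanGamma μ))ᴴ s₀ s) *
            (((1 : Matrix (Fin 3) (Fin 3) ℂ) ⊗ₖ ((((∑ μ : Fin 4, (1 - Real.cos (2 * π * (ZMod.val (k' μ) : ℝ) / L))) : ℝ) : ℂ) • (1 : Matrix (Fin 4) (Fin 4) ℂ) +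
          I • ∑ μ : Fin 4, ((Real.sin (2 * π * (ZMod.val (k' μ) : ℝ) / L) : ℝ) : ℂ) • euclideanGamma μ)) s s₀')) := by
    intro x s
    simp only [Matrix.conjTranspose_apply, Matrix.of_apply, star_mul']
    ring
  simp_rw [hs]
  rw [← Finset.sum_mul_sum, ← Matrix.mul_apply, ← Matrix.mul_apply, planeF_conjTranspose_mul_self,
    Matrix.one_apply]
  by_cases hk : k = k'
  · subst hk
    rw [if_pos rfl, one_mul, conjTranspose_kronecker, ← mul_kronecker_mul, conjTranspose_one,
      Matrix.one_mul, clifford_conjTranspose_mul_self, Matrix.kronecker_smul, one_kronecker_one,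
      Matrix.smul_apply, Matrix.one_apply, smul_eq_mul, mul_ite, mul_one, mul_zero]
    simp only [Prod.mk.injEq, true_and]
  · rw [if_neg hk, zero_mul, if_neg (fun h => hk (Prod.mk.injEq _ _ _ _ ▸ h).1)]

/-- **The free heat kernel in Fourier variables** (all entries): for real `t`,
`exp(−t D₀ᴴD₀)((x,a,α),(y,b,β)) = δ_{(a,α),(b,β)} · L⁻⁴ Σ_k e^{−t h(k)} χ_k(x) conj χ_k(y)`,
`h(k) = (Σ_μ (1 − cos θ_μ))² + Σ_μ sin² θ_μ`, `θ_μ = 2π k_μ.val / L`. -/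
theorem exp_freeWilson_apply (t : ℝ) (x y : TorusSite 4 L) (a b : Fin 3) (α β : Fin 4) :
    (NormedSpace.exp (-(t : ℂ) •
        ((wilsonDirac (fundamentalRep (Fin 3)) (1 : GaugeConfig 4 L (Matrix.specialUnitaryGroup (Fin 3) ℂ)) 0 1)ᴴ *
          wilsonDirac (fundamentalRep (Fin 3)) (1 : GaugeConfig 4 L (Matrix.specialUnitaryGroup (Fin 3) ℂ)) 0 1))) (x, a, α) (y, b, β) =
      if (a, α) = (b, β) then
        ∑ k : TorusSite 4 L, ((L : ℂ) ^ 2)⁻¹ * ((L : ℂ) ^ 2)⁻¹ *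
          (Complex.exp (-(t : ℂ) * ((((∑ μ : Fin 4, (1 - Real.cos (2 * π * (ZMod.val (k μ) : ℝ) / L))) ^ 2 +
          ∑ μ : Fin 4, Real.sin (2 * π * (ZMod.val (k μ) : ℝ) / L) ^ 2) : ℝ) : ℂ)) *
            (torusChar k x * conj (torusChar k y)))
      else 0 := by
  set P : Matrix (TorusSite 4 L × Fin 3 × Fin 4) (TorusSite 4 L × Fin 3 × Fin 4) ℂ :=
    ((Matrix.of fun x k : TorusSite 4 L => ((L : ℂ) ^ 2)⁻¹ * torusChar k x) ⊗ₖ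
        (1 : Matrix (Fin 3 × Fin 4) (Fin 3 × Fin 4) ℂ)) with hP
  have hd : (wilsonDirac (fundamentalRep (Fin 3)) (1 : GaugeConfig 4 L (Matrix.specialUnitaryGroup (Fin 3) ℂ)) 0 1 * P)ᴴ *
      (wilsonDirac (fundamentalRep (Fin 3)) (1 : GaugeConfig 4 L (Matrix.specialUnitaryGroup (Fin 3) ℂ)) 0 1 * P) =
      diagonal fun q : TorusSite 4 L × Fin 3 × Fin 4 =>
        ((((∑ μ : Fin 4, (1 - Real.cos (2 * π * (ZMod.val (q.1 μ) : ℝ) / L))) ^ 2 +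
          ∑ μ : Fin 4, Real.sin (2 * π * (ZMod.val (q.1 μ) : ℝ) / L) ^ 2) : ℝ) : ℂ) := by
    rw [hP, wilsonDirac_one_mul_planeP]
    exact symQ_conjTranspose_mul_self
  have hPu : Pᴴ * P = 1 := by rw [hP]; exact planeP_conjTranspose_mul_self
  rw [exp_neg_smul_conjTranspose_mul_self_apply P _ _ hPu hd t, Fintype.sum_prod_type]
  have hs : ∀ (k : TorusSite 4 L) (s : Fin 3 × Fin 4),
      P (x, a, α) (k, s) * Complex.exp (-(t : ℂ) * ((((∑ μ : Fin 4, (1 - Real.cos (2 * π * (ZMod.val (k μ) : ℝ) / L))) ^ 2 +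
          ∑ μ : Fin 4, Real.sin (2 * π * (ZMod.val (k μ) : ℝ) / L) ^ 2) : ℝ) : ℂ)) *
          conj (P (y, b, β) (k, s)) =
        (((L : ℂ) ^ 2)⁻¹ * ((L : ℂ) ^ 2)⁻¹ *
            (Complex.exp (-(t : ℂ) * ((((∑ μ : Fin 4, (1 - Real.cos (2 * π * (ZMod.val (k μ) : ℝ) / L))) ^ 2 +
          ∑ μ : Fin 4, Real.sin (2 * π * (ZMod.val (k μ) : ℝ) / L) ^ 2) : ℝ) : ℂ)) *
              (torusChar k x * conj (torusChar k y)))) *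
          ((1 : Matrix (Fin 3 × Fin 4) (Fin 3 × Fin 4) ℂ) (a, α) s *
            (1 : Matrix (Fin 3 × Fin 4) (Fin 3 × Fin 4) ℂ) s (b, β)) := by
    intro k s
    rw [hP, Matrix.kroneckerMap_apply, Matrix.kroneckerMap_apply, Matrix.of_apply, Matrix.of_apply,
      map_mul, map_mul, conj_one_apply, map_inv₀, map_pow, map_natCast]
    ring
  simp_rw [hs]
  rw [← Finset.sum_mul_sum, ← Matrix.mul_apply, Matrix.one_mul, Matrix.one_apply, mul_ite, mul_one,
    mul_zero]

/-- **The free on-site heat kernel is the real Fourier sum, diagonal in colour–spin**: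
`exp(−t D₀ᴴD₀)((x,a,α),(x,b,β)) = δ_{(a,α),(b,β)} · L⁻⁴ Σ_k e^{−t h(k)}` with
`h(k) = (Σ_μ (1 − cos θ_μ))² + Σ_μ sin² θ_μ`, `θ_μ = 2π k_μ.val / L`. -/
theorem exp_freeWilson_apply_site (t : ℝ) (x : TorusSite 4 L) (a b : Fin 3) (α β : Fin 4) :
    (NormedSpace.exp (-(t : ℂ) •
        ((wilsonDirac (fundamentalRep (Fin 3)) (1 : GaugeConfig 4 L (Matrix.specialUnitaryGroup (Fin 3) ℂ)) 0 1)ᴴ *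
          wilsonDirac (fundamentalRep (Fin 3)) (1 : GaugeConfig 4 L (Matrix.specialUnitaryGroup (Fin 3) ℂ)) 0 1))) (x, a, α) (x, b, β) =
      if (a, α) = (b, β) then
        (((1 / (L : ℝ) ^ 4 * ∑ k : TorusSite 4 L, Real.exp (-(t *
          ((∑ μ : Fin 4, (1 - Real.cos (2 * π * (ZMod.val (k μ) : ℝ) / L))) ^ 2 +
          ∑ μ : Fin 4, Real.sin (2 * π * (ZMod.val (k μ) : ℝ) / L) ^ 2)))) : ℝ) : ℂ)
      else 0 := by
  rw [exp_freeWilson_apply]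
  simp only [torusChar_mul_conj, mul_one]
  congr 1
  push_cast
  rw [Finset.mul_sum]
  refine Finset.sum_congr rfl fun k _ => ?_
  rw [neg_mul, ← mul_inv, ← pow_add, one_div]

end Concrete

end

end Summit.QuantumFields.QCD.Theorems.HeatSlicedQuarks.FreeKernel
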